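import Literature.NumberTheory.Automorphic.ClosedCompactDecomposition
import Mathlib.MeasureTheory.Measure.Haar.Unique
import Mathlib.MeasureTheory.Integral.Bochner.Set
import Mathlib.Topology.Maps.Proper.CompactlyGenerated
import HarnessLib

/-!
# Haar integral over `G = H K`, general locally compact groups: the `H ∩ K`-average

Topic `NumberTheory/Automorphic`; namespace `Literature.NumberTheory.Automorphic.HaarHK`. This file
starts the proof of Deitmar–Echterhoff, *Principles of Harmonic Analysis* (2014), Prop. 1.5.6
(`∫_G f = c ∫_H ∫_K f(hk)` for `G = HK`, `H` closed, `K` compact; statement file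
`HaarIntegralClosedCompact.lean`) **for arbitrary locally compact Hausdorff groups and arbitrary
Haar measures**, complementing `HaarIntegralClosedCompactProofs.lean` (`HaarHK.…`), which proves it
for *second-countable* `G` by running an invariant-functional argument on `C_c(H × K)`.

Why a second device is needed. The second-countable proof uses, essentially, (i) the Baire open
mapping theorem for `H × K → G` (`isOpenMap_subgroup_mul`), (ii) first countability for the
continuity of parametric integrals, and (iii) the product Haar measure `μ_H ⊗ μ_K` and Haar
uniqueness on `H × K`, which need `BorelSpace (H × K)`; for a general locally compact group the
multiplication `(h, k) ↦ hk` need not even be measurable for the product σ-algebra. Here the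
functional is run on `C_c(H)` instead, which involves no products: for `ψ : H → ℝ` let
`cosetAvg ψ (h) = ∫_{H ∩ K} ψ(h l) dl` (Haar measure of the compact group `H ∩ K ≤ H`, realised as
`K.subgroupOf H`) and extend it to `G = HK` by `extendAvg ψ (h k) = cosetAvg ψ (h)` — well defined
because two decompositions differ by an element of `H ∩ K` (`extendAvg_mul`). (Informally,
`extendAvg ψ = HaarHK.descend (ψ ∘ Prod.fst)` up to the normalisation of the Haar measure of the
stabiliser.) This file proves the topological and algebraic properties of these two devices:

* the multiplication map `H × K → G` is continuous, surjective, **proper**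
  (`isCompact_preimage_subgroup_mul` of `ClosedCompactDecomposition`), hence closed and a
  **quotient map** (`isQuotientMap_subgroup_mul` — no Baire category, no countability);
* `Δ_G ≡ 1` on compact subgroups in the regularity-free form
  `haarScalarFactor (map (· * k) μ) μ = 1`, `∫ f(xk) dμ = ∫ f dμ` for `f ∈ C_c(G, ℝ)` and *every*
  Mathlib `IsHaarMeasure μ` (`integral_mul_right_eq_self_of_mem_compact`);
* `cosetAvg`, `extendAvg`: well-definedness, continuity (through the quotient map), compact
  support, linearity, positivity, `H`-equivariance, and `extendAvg (φ|_H) = haar(H ∩ K) · φ` for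
  right-`K`-invariant `φ`.

The functional argument (Riesz–Markov on `H`) is in `HaarIntegralClosedCompactCcGeneral.lean`, the
passage to `L¹` for Radon Haar measures in `HaarIntegralClosedCompactRadonSets.lean` and
`HaarIntegralClosedCompactRadon.lean`.

## References

* A. Deitmar, S. Echterhoff, *Principles of Harmonic Analysis*, 2nd ed., Universitext, Springer
  (2014), §1.5, Prop. 1.5.6 (p. 21) and its proof. [DeitmarEchterhoff2014]
-/

noncomputable section

open MeasureTheory Measure Set Topology
open scoped ENNReal NNReal Pointwise

namespace Literature.NumberTheory.Automorphic.HaarHK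

section Algebra

variable {G : Type*} [Group G] {H K : Subgroup G}

/-- `G = HK` means the multiplication map `H × K → G` is surjective. [folklore] -/
lemma surjective_subgroup_mul (hHK : ∀ g : G, ∃ h ∈ H, ∃ k ∈ K, g = h * k) :
    Function.Surjective fun p : ↥H × ↥K => (p.1 : G) * (p.2 : G) := by
  intro g
  obtain ⟨h, hh, k, hk, rfl⟩ := hHK g
  exact ⟨(⟨h, hh⟩, ⟨k, hk⟩), rfl⟩

/-- Two `HK`-decompositions of the same element differ by an element of `H ∩ K`:
`h₁ k₁ = h₂ k₂ ⟹ h₂⁻¹ h₁ ∈ K`. [folklore] -/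
lemma inv_mul_mem_of_mul_eq_mul {h₁ h₂ k₁ k₂ : G} (hk₁ : k₁ ∈ K) (hk₂ : k₂ ∈ K)
    (he : h₁ * k₁ = h₂ * k₂) : h₂⁻¹ * h₁ ∈ K := by
  have : h₂⁻¹ * h₁ = k₂ * k₁⁻¹ := by
    calc h₂⁻¹ * h₁ = h₂⁻¹ * (h₁ * k₁) * k₁⁻¹ := by group
      _ = h₂⁻¹ * (h₂ * k₂) * k₁⁻¹ := by rw [he]
      _ = k₂ * k₁⁻¹ := by group
  rw [this]
  exact K.mul_mem hk₂ (K.inv_mem hk₁)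

end Algebra

section Topology

variable {G : Type*} [Group G] [TopologicalSpace G] {H K : Subgroup G}

/-- `H ∩ K` (as the subgroup `K.subgroupOf H` of `H`) is compact when `H` is closed and `K` compact.
[folklore] -/
lemma isCompact_subgroupOf (hH : IsClosed (H : Set G)) (hK : IsCompact (K : Set G)) :
    IsCompact (K.subgroupOf H : Set H) :=
  hH.isClosedEmbedding_subtypeVal.isCompact_preimage hK

variable [IsTopologicalGroup G]

/-- The multiplication map `H × K → G` is continuous. [folklore] -/
lemma continuous_subgroup_mul (H K : Subgroup G) :
    Continuous fun p : ↥H × ↥K => (p.1 : G) * (p.2 : G) :=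
  (continuous_subtype_val.comp continuous_fst).mul (continuous_subtype_val.comp continuous_snd)

/-- `l ↦ h l` is continuous `H ∩ K → H`. [folklore] -/
lemma continuous_mul_coe_subgroupOf (h : H) : Continuous fun l : K.subgroupOf H => h * (l : H) :=
  continuous_const.mul continuous_subtype_val

/-- For `H` closed and `K` compact the multiplication map `H × K → G` is **proper**
(`isCompact_preimage_subgroup_mul`). [folklore] -/
lemma isProperMap_subgroup_mul [T2Space G] [LocallyCompactSpace G]
    (hH : IsClosed (H : Set G)) (hK : IsCompact (K : Set G)) :
    IsProperMap fun p : ↥H × ↥K => (p.1 : G) * (p.2 : G) :=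
  isProperMap_iff_isCompact_preimage.2
    ⟨continuous_subgroup_mul H K, fun _ hC => isCompact_preimage_subgroup_mul hH hK hC⟩

/-- For `H` closed, `K` compact and `G = HK`, the multiplication map `H × K → G` is a **quotient
map**, being a continuous closed (proper) surjection — valid for every locally compact group
(compare `isOpenMap_subgroup_mul`, which needs second countability). [folklore] -/
lemma isQuotientMap_subgroup_mul [T2Space G] [LocallyCompactSpace G]
    (hH : IsClosed (H : Set G)) (hK : IsCompact (K : Set G))
    (hHK : ∀ g : G, ∃ h ∈ H, ∃ k ∈ K, g = h * k) :
    IsQuotientMap fun p : ↥H × ↥K => (p.1 : G) * (p.2 : G) :=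
  (isProperMap_subgroup_mul hH hK).isClosedMap.isQuotientMap (continuous_subgroup_mul H K)
    (surjective_subgroup_mul hHK)

/-- A compactly supported function pulled back along the proper multiplication map `H × K → G`
is compactly supported. [folklore] -/
lemma hasCompactSupport_comp_subgroup_mul [T2Space G] [LocallyCompactSpace G]
    (hH : IsClosed (H : Set G)) (hK : IsCompact (K : Set G)) {E : Type*} [Zero E] {f : G → E}
    (hcs : HasCompactSupport f) :
    HasCompactSupport (f ∘ fun p : ↥H × ↥K => (p.1 : G) * (p.2 : G)) :=
  HasCompactSupport.intro' (isCompact_preimage_subgroup_mul hH hK hcs.isCompact)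
    ((isClosed_tsupport f).preimage (continuous_subgroup_mul H K))
    fun _ hp => image_eq_zero_of_notMem_tsupport (f := f) hp

end Topology

section Invariance

variable {G : Type*} [Group G] [TopologicalSpace G] [IsTopologicalGroup G] [T2Space G]
  [LocallyCompactSpace G] [MeasurableSpace G] [BorelSpace G] {K : Subgroup G}

/-- **`Δ_G` is trivial on compact subgroups.** For a left Haar measure `μ` on `G` (any Mathlib
`IsHaarMeasure`, no regularity assumed) and `k` in a compact subgroup `K`, the Haar scalar factor of
the left Haar measure `map (· * k) μ` against `μ` is `1`: both give the same mass to the compact set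
`Q K` (`Q` a positive compact), which is invariant under right multiplication by `k`. (Compare
`HaarHK.map_mul_right_eq_self_of_mem_compact`, the measure identity for second-countable `G`.)
[cite: DeitmarEchterhoff2014, proof of Prop. 1.5.6] -/
lemma haarScalarFactor_map_mul_right_eq_one_of_mem_compact (μ : Measure G) [IsHaarMeasure μ]
    (hK : IsCompact (K : Set G)) {k : G} (hk : k ∈ K) :
    haarScalarFactor (map (· * k) μ) μ = 1 := by
  obtain ⟨Q⟩ : Nonempty (TopologicalSpace.PositiveCompacts G) := inferInstance
  set s : Set G := (Q : Set G) * (K : Set G) with hs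
  have hsc : IsCompact s := Q.isCompact.mul hK
  have hmeas : MeasurableSet s := hsc.isClosed.measurableSet
  have hpre : (fun x => x * k) ⁻¹' s = s := by
    ext x
    simp only [mem_preimage, hs, Set.mem_mul]
    constructor
    · rintro ⟨q, hq, k', hk', hx⟩
      refine ⟨q, hq, k' * k⁻¹, K.mul_mem hk' (K.inv_mem hk), ?_⟩
      rw [← mul_assoc, hx, mul_inv_cancel_right]
    · rintro ⟨q, hq, k', hk', rfl⟩
      exact ⟨q, hq, k' * k, K.mul_mem hk' hk, (mul_assoc _ _ _).symm⟩
  have h0 : μ s ≠ 0 := by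
    have hQs : (Q : Set G) ⊆ s := fun q hq => ⟨q, hq, 1, K.one_mem, mul_one q⟩
    exact ((measure_pos_of_nonempty_interior μ Q.interior_nonempty).trans_le
      (measure_mono hQs)).ne'
  have htop : μ s ≠ ∞ := hsc.measure_lt_top.ne
  have h1 := measure_isMulInvariant_eq_smul_of_isCompact_closure (map (· * k) μ) μ
    (s := s) (by rw [hsc.isClosed.closure_eq]; exact hsc)
  rw [map_apply (measurable_mul_const k) hmeas, hpre] at h1
  have h2 : ((haarScalarFactor (map (· * k) μ) μ : ℝ≥0∞)) * μ s = μ s := by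
    simpa [ENNReal.smul_def, smul_eq_mul] using h1.symm
  exact_mod_cast (ENNReal.mul_eq_right h0 htop).mp h2

/-- **Right invariance of a left Haar integral under a compact subgroup**: for `k` in a compact
subgroup `K ≤ G`, every left Haar measure `μ` (no regularity assumed) and every `f ∈ C_c(G, ℝ)`,
`∫ f(x k) dμ(x) = ∫ f dμ`. [cite: DeitmarEchterhoff2014, proof of Prop. 1.5.6] -/
theorem integral_mul_right_eq_self_of_mem_compact (μ : Measure G) [IsHaarMeasure μ]
    (hK : IsCompact (K : Set G)) {k : G} (hk : k ∈ K) {f : G → ℝ} (hf : Continuous f)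
    (hcs : HasCompactSupport f) : ∫ x, f (x * k) ∂μ = ∫ x, f x ∂μ := by
  calc ∫ x, f (x * k) ∂μ = ∫ x, f x ∂(map (· * k) μ) := by
        rw [integral_map (measurable_mul_const k).aemeasurable hf.aestronglyMeasurable]
    _ = ∫ x, f x ∂(haarScalarFactor (map (· * k) μ) μ • μ) :=
        integral_isMulLeftInvariant_eq_smul_of_hasCompactSupport _ _ hf hcs
    _ = ∫ x, f x ∂μ := by
        rw [haarScalarFactor_map_mul_right_eq_one_of_mem_compact μ hK hk, one_smul]

end Invariance

section Average

variable {G : Type*} [Group G] [TopologicalSpace G] [IsTopologicalGroup G] [MeasurableSpace G]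
  [BorelSpace G] {H K : Subgroup G}

/-- A continuous real function on a compact space is integrable for a measure finite on compacts.
[folklore] -/
lemma integrable_of_continuous_of_compactSpace {X : Type*} [TopologicalSpace X] [CompactSpace X]
    [MeasurableSpace X] [OpensMeasurableSpace X] {μ : Measure X} [IsFiniteMeasureOnCompacts μ]
    {f : X → ℝ} (hf : Continuous f) : Integrable f μ :=
  hf.integrable_of_hasCompactSupport (HasCompactSupport.of_compactSpace f)

/-- The **`H ∩ K`-average** `h ↦ ∫_{H ∩ K} ψ(h l) dl` of a function `ψ` on `H`, with respect to the
Haar measure `haar` of the compact group `H ∩ K = K.subgroupOf H` (total mass not normalised).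
[folklore] -/
def cosetAvg (H K : Subgroup G) [CompactSpace (K.subgroupOf H)] (ψ : H → ℝ) (h : H) : ℝ :=
  ∫ l : K.subgroupOf H, ψ (h * (l : H)) ∂haar

variable [CompactSpace (K.subgroupOf H)]

/-- Unfolding `cosetAvg`. [folklore] -/
lemma cosetAvg_def (ψ : H → ℝ) (h : H) :
    cosetAvg H K ψ h = ∫ l : K.subgroupOf H, ψ (h * (l : H)) ∂haar := rfl

/-- `cosetAvg` is right-`(H ∩ K)`-invariant. [folklore] -/
lemma cosetAvg_mul_coe (ψ : H → ℝ) (h : H) (l₀ : K.subgroupOf H) :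
    cosetAvg H K ψ (h * (l₀ : H)) = cosetAvg H K ψ h := by
  unfold cosetAvg
  have : (fun l : K.subgroupOf H => ψ (h * (l₀ : H) * (l : H))) =
      fun l => (fun l' : K.subgroupOf H => ψ (h * (l' : H))) (l₀ * l) := by
    funext l
    simp only [Subgroup.coe_mul, mul_assoc]
  rw [this]
  exact integral_mul_left_eq_self (μ := haar) (fun l' : K.subgroupOf H => ψ (h * (l' : H))) l₀

/-- `cosetAvg ψ` vanishes at `h` if `ψ` vanishes on the coset `h (H ∩ K)`. [folklore] -/
lemma cosetAvg_eq_zero {ψ : H → ℝ} {h : H} (h0 : ∀ l : K.subgroupOf H, ψ (h * (l : H)) = 0) :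
    cosetAvg H K ψ h = 0 := by
  simp [cosetAvg, h0]

/-- `cosetAvg ψ` is continuous for continuous `ψ` (parametric integral over a compact group; no
countability needed). [folklore] -/
lemma continuous_cosetAvg {ψ : H → ℝ} (hψ : Continuous ψ) : Continuous (cosetAvg H K ψ) := by
  have hc : ContinuousOn (cosetAvg H K ψ) univ := by
    unfold cosetAvg
    exact continuousOn_integral_of_compact_support (k := (univ : Set (K.subgroupOf H)))
      isCompact_univ
      ((hψ.comp (continuous_fst.mul (continuous_subtype_val.comp continuous_snd))).continuousOn)
      (fun p x _ hx => absurd (mem_univ x) hx)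
  exact continuousOn_univ.mp hc

/-- `cosetAvg` is constant along right-`K`-translates for restrictions of right-`K`-invariant
functions: `cosetAvg (φ|_H) h = haar(H ∩ K) φ(h)`. [folklore] -/
lemma cosetAvg_restrict_of_mul_right_invariant {φ : G → ℝ}
    (hφ : ∀ (g : G) (k : G), k ∈ K → φ (g * k) = φ g) (h : H) :
    cosetAvg H K (fun h : H => φ h) h = (haar : Measure (K.subgroupOf H)).real univ * φ h := by
  unfold cosetAvg
  have : ∀ l : K.subgroupOf H, φ ((h * (l : H) : H) : G) = φ h := fun l => by
    rw [Subgroup.coe_mul, hφ _ _ (Subgroup.mem_subgroupOf.mp l.2)]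
  simp_rw [this, integral_const, smul_eq_mul]

omit [CompactSpace (K.subgroupOf H)] in
/-- Positivity of the total Haar mass of the compact group `H ∩ K`. [folklore] -/
lemma haar_real_univ_subgroupOf_pos (H K : Subgroup G) [CompactSpace (K.subgroupOf H)] :
    0 < (haar : Measure (K.subgroupOf H)).real univ :=
  ENNReal.toReal_pos (isOpen_univ.measure_pos _ univ_nonempty).ne' (measure_lt_top _ _).ne

variable (hHK : ∀ g : G, ∃ h ∈ H, ∃ k ∈ K, g = h * k)

/-- The **extension** `E ψ` of the `H ∩ K`-average of `ψ : H → ℝ` to `G = HK`: at `g` it is the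
average over the coset `h (H ∩ K)` of any (here: a chosen) `h ∈ H` with `g ∈ h K`; by
`extendAvg_mul` it satisfies `E ψ (h k) = cosetAvg H K ψ h` for *all* `h ∈ H`, `k ∈ K`, so it does
not depend on the choice, and it is right-`K`-invariant by construction. [folklore] -/
def extendAvg (ψ : H → ℝ) (g : G) : ℝ :=
  cosetAvg H K ψ ⟨(hHK g).choose, (hHK g).choose_spec.1⟩

/-- **Key formula**: `E ψ (h k) = ∫_{H ∩ K} ψ (h l) dl`. [folklore] -/
lemma extendAvg_mul (ψ : H → ℝ) (h : H) (k : K) :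
    extendAvg hHK ψ ((h : G) * k) = cosetAvg H K ψ h := by
  unfold extendAvg
  set g : G := (h : G) * k with hg
  obtain ⟨k', hk', he⟩ := (hHK g).choose_spec.2
  have hmem : h⁻¹ * ⟨(hHK g).choose, (hHK g).choose_spec.1⟩ ∈ K.subgroupOf H := by
    rw [Subgroup.mem_subgroupOf, Subgroup.coe_mul, Subgroup.coe_inv]
    exact inv_mul_mem_of_mul_eq_mul hk' k.2 he.symm
  have : (⟨(hHK g).choose, (hHK g).choose_spec.1⟩ : H) =
      h * ((⟨h⁻¹ * ⟨(hHK g).choose, (hHK g).choose_spec.1⟩, hmem⟩ : K.subgroupOf H) : H) := by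
    simp only [mul_inv_cancel_left]
  rw [this, cosetAvg_mul_coe]

/-- `E ψ` is right-`K`-invariant. [folklore] -/
lemma extendAvg_mul_right (ψ : H → ℝ) (g : G) {k : G} (hk : k ∈ K) :
    extendAvg hHK ψ (g * k) = extendAvg hHK ψ g := by
  obtain ⟨h, hh, k₁, hk₁, rfl⟩ := hHK g
  rw [mul_assoc, show h * (k₁ * k) = ((⟨h, hh⟩ : H) : G) * ((⟨k₁ * k, K.mul_mem hk₁ hk⟩ : K) : G)
    from rfl, extendAvg_mul, show h * k₁ = ((⟨h, hh⟩ : H) : G) * ((⟨k₁, hk₁⟩ : K) : G) from rfl,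
    extendAvg_mul]

/-- `E ψ` is continuous for continuous `ψ`: the multiplication map `H × K → G` is a quotient map and
`E ψ ∘ (h, k ↦ hk) = cosetAvg ψ ∘ fst`. [folklore] -/
lemma continuous_extendAvg [T2Space G] [LocallyCompactSpace G] (hH : IsClosed (H : Set G))
    (hK : IsCompact (K : Set G)) {ψ : H → ℝ} (hψ : Continuous ψ) :
    Continuous (extendAvg hHK ψ) := by
  rw [(isQuotientMap_subgroup_mul hH hK hHK).continuous_iff]
  have : (extendAvg hHK ψ ∘ fun p : ↥H × ↥K => (p.1 : G) * (p.2 : G)) =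
      fun p => cosetAvg H K ψ p.1 := by
    funext p
    simp only [Function.comp_apply, extendAvg_mul]
  rw [this]
  exact (continuous_cosetAvg hψ).comp continuous_fst

/-- `E ψ` has compact support if `ψ` has: its support lies in `(tsupport ψ) K`. [folklore] -/
lemma hasCompactSupport_extendAvg [CompactSpace K] {ψ : H → ℝ} (hψc : HasCompactSupport ψ) :
    HasCompactSupport (extendAvg hHK ψ) := by
  refine HasCompactSupport.intro
    (K := (fun p : ↥H × ↥K => (p.1 : G) * (p.2 : G)) '' (tsupport ψ ×ˢ (univ : Set K)))
    ((hψc.isCompact.prod isCompact_univ).image (continuous_subgroup_mul H K)) (fun g hg => ?_)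
  obtain ⟨h, hh, k, hk, rfl⟩ := hHK g
  rw [show h * k = ((⟨h, hh⟩ : H) : G) * ((⟨k, hk⟩ : K) : G) from rfl, extendAvg_mul]
  refine cosetAvg_eq_zero (fun l => ?_)
  by_contra hne
  apply hg
  have hlK : ((l : H) : G) ∈ K := Subgroup.mem_subgroupOf.mp l.2
  refine ⟨(⟨h, hh⟩ * (l : H), ⟨((l : H) : G)⁻¹ * k, K.mul_mem (K.inv_mem hlK) hk⟩),
    ⟨subset_tsupport _ hne, mem_univ _⟩, ?_⟩
  simp only [Subgroup.coe_mul]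
  rw [mul_assoc, mul_inv_cancel_left]

/-- `E` is additive on continuous functions. [folklore] -/
lemma extendAvg_add {ψ₁ ψ₂ : H → ℝ} (h₁ : Continuous ψ₁) (h₂ : Continuous ψ₂) :
    extendAvg hHK (ψ₁ + ψ₂) = extendAvg hHK ψ₁ + extendAvg hHK ψ₂ := by
  funext g
  simp only [extendAvg, cosetAvg, Pi.add_apply]
  exact integral_add
    (integrable_of_continuous_of_compactSpace (h₁.comp (continuous_mul_coe_subgroupOf _)))
    (integrable_of_continuous_of_compactSpace (h₂.comp (continuous_mul_coe_subgroupOf _)))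

/-- `E` is homogeneous. [folklore] -/
lemma extendAvg_smul (c : ℝ) (ψ : H → ℝ) : extendAvg hHK (c • ψ) = c • extendAvg hHK ψ := by
  funext g
  simp only [extendAvg, cosetAvg, Pi.smul_apply, smul_eq_mul]
  exact integral_const_mul c _

/-- `E` is positive. [folklore] -/
lemma extendAvg_nonneg {ψ : H → ℝ} (h0 : ∀ x, 0 ≤ ψ x) (g : G) : 0 ≤ extendAvg hHK ψ g := by
  unfold extendAvg cosetAvg
  exact integral_nonneg fun _ => h0 _

/-- `E` commutes with left translations by `H`: `E(ψ(h₀ ·))(g) = E ψ (h₀ g)`. [folklore] -/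
lemma extendAvg_comp_mul_left (ψ : H → ℝ) (h₀ : H) (g : G) :
    extendAvg hHK (fun x => ψ (h₀ * x)) g = extendAvg hHK ψ ((h₀ : G) * g) := by
  obtain ⟨h, hh, k, hk, rfl⟩ := hHK g
  rw [show h * k = ((⟨h, hh⟩ : H) : G) * ((⟨k, hk⟩ : K) : G) from rfl, extendAvg_mul, ← mul_assoc,
    show (h₀ : G) * h * k = ((h₀ * ⟨h, hh⟩ : H) : G) * ((⟨k, hk⟩ : K) : G) from rfl, extendAvg_mul]
  simp only [cosetAvg, mul_assoc]

/-- On (restrictions to `H` of) right-`K`-invariant functions `φ` on `G`, `E` is multiplication by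
the total mass of `H ∩ K`: `E(φ|_H) = haar(H ∩ K) · φ`. [folklore] -/
lemma extendAvg_restrict_of_mul_right_invariant {φ : G → ℝ}
    (hφ : ∀ (g : G) (k : G), k ∈ K → φ (g * k) = φ g) (g : G) :
    extendAvg hHK (fun h : H => φ h) g =
      (haar : Measure (K.subgroupOf H)).real univ * φ g := by
  obtain ⟨h, hh, k, hk, rfl⟩ := hHK g
  rw [show h * k = ((⟨h, hh⟩ : H) : G) * ((⟨k, hk⟩ : K) : G) from rfl, extendAvg_mul,
    cosetAvg_restrict_of_mul_right_invariant hφ, hφ _ _ hk]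

end Average

end Literature.NumberTheory.Automorphic.HaarHK
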